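import Summits.CriticalPhenomena.PercolationContinuityZ3.Theorems.Transplant.FKConnectivityAllQPat3KNetSPBridgeI
import Summits.CriticalPhenomena.PercolationContinuityZ3.Theorems.Transplant.FKConnectivityAllQPat3KNetSPBridgePb
import Summits.CriticalPhenomena.PercolationContinuityZ3.Theorems.Transplant.FKConnectivityAllQPat3KNetSPLeavesClaw
import Summits.CriticalPhenomena.PercolationContinuityZ3.Theorems.Transplant.FKConnectivityAllQPat3KNetSPLeavesVee
import Summits.CriticalPhenomena.PercolationContinuityZ3.Theorems.Transplant.FKConnectivityAllQPat3KNetSPLeavesTri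
import Summits.CriticalPhenomena.PercolationContinuityZ3.Theorems.Transplant.FKConnectivityAllQPat3KNetSPLeavesPath
import Summits.CriticalPhenomena.PercolationContinuityZ3.Theorems.Transplant.FKConnectivityAllQPat3KNetReroot
import Summits.CriticalPhenomena.PercolationContinuityZ3.Theorems.Transplant.FKConnectivityAllQPat3MinorRecursion
import HarnessLib

/-!
# Connectivity correlation inequalities for `φ_{w,q}`, every `q > 0` — THEOREM SP(𝒦) on MINORS: the inner recursion (type I, one marked pole)

Proof file (`--supports stmt-CriticalPhenomena-4575`), census lineage (gen 41) of LANE 2's FK sub-programme; builds on p205010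
(kernel theorem, internal audit signed; external expert review pending).  No definitions, no named facts, no sorries.

Census g37's minor recursion («Pat3MinorRecursion», two-terminal series–parallel networks) ONE RUNG UP, for the class 𝒦 of
bridge–series–parallel networks (`FK.IsKNet`, census g41 «Pat3KNetDefs»; `K₄ ∈ 𝒦`): the edge / series / parallel cases are census g37's
verbatim (re-rooting «Pat3KNetReroot», leaves «Pat3KNetSPSteps»), the NEW case — the side being decomposed is a BRIDGE — is the
position dispatch «Pat3KNetSPBridgeI» / «Pat3KNetSPBridgePb» over views of the completed `K₄` («Pat3KNetViewsPar») with the twelve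
K-state leaves («Pat3KNetSPLeavesVee/Tri/Path/Claw», via the generic placement lemmas on `FK.K4Sep`).  Because the leaves shrink and
erase mark-free 𝒦-slots, every statement carries the OUTER induction hypothesis `ihSP` (THEOREM SP below `N₀ ⊇ E₁ ∪ E₂`) as a section
hypothesis.  `FK.typeIK_good`, `FK.pbK_good`.
[cite: AyyerLinussonRavichandran2025, §7 (p. 22)] [cite: Grimmett2006, §3.9 (pp. 63–64)]
-/

namespace Summit.CriticalPhenomena.PercolationContinuityZ3.Theorems

namespace FK

open SimpleGraph Literature.Probability.LatticeModels Literature.Probability.Percolation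
open scoped Classical

variable {V : Type*}

-- `FK.inter_union2_eq / inter_union3_eq`: imported from «Pat3MinorRecursion».

/-! ### Type I on minors -/

section TypeIC

variable [Fintype V] {F₁ F₂ E₂ : Finset (Sym2 V)} {x m y : V} {E C : Finset (Sym2 V)}

variable {N₀ : Finset (Sym2 V)}
  (ihSP : ∀ {N' E' C' : Finset (Sym2 V)} {x' y' b' s' t' : V}, N'.card < N₀.card → IsKNet N' x' y' → E' ⊆ N' → C' ⊆ N' →
    (∃ e ∈ N', b' ∈ e) → (∃ e ∈ N', s' ∈ e) → (∃ e ∈ N', t' ∈ e) → b' ≠ s' → b' ≠ t' → s' ≠ t' → SPGoodC E' C' b' s' t')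

/-- Type I on minors, series case with a mark at the junction `m`: CORNER after re-rooting. [cite: AyyerLinussonRavichandran2025, §7 (p. 22)] -/
theorem typeIK_junction {b t : V} (h₂ : IsKNet E₂ x y) (hd : Disjoint (F₁ ∪ F₂) E₂)
    (hV : ∀ z : V, (∃ e ∈ F₁ ∪ F₂, z ∈ e) → (∃ e ∈ E₂, z ∈ e) → z = x ∨ z = y)
    (hF₁ : IsKNet F₁ x m) (hF₂ : IsKNet F₂ m y) (hdF : Disjoint F₁ F₂)
    (hVF : ∀ z : V, (∃ e ∈ F₁, z ∈ e) → (∃ e ∈ F₂, z ∈ e) → z = m) (hxF₂ : ∀ e ∈ F₂, x ∉ e) (hyF₁ : ∀ e ∈ F₁, y ∉ e)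
    (hE : E ⊆ F₁ ∪ F₂ ∪ E₂) (hC : C ⊆ F₁ ∪ F₂ ∪ E₂)
    (ht : ∃ e ∈ F₁ ∪ F₂, t ∈ e) (htm : t ≠ m) (htx : t ≠ x) (hty : t ≠ y)
    (hb : ∃ e ∈ E₂, b ∈ e) (hbx : b ≠ x) (hby : b ≠ y) : SPGoodC E C b m t := by
  obtain ⟨eb, heb, hbeb⟩ := hb
  have hbm : b ≠ m := fun h => junction_not_memK hV hF₁ hF₂ eb heb (h ▸ hbeb)
  rcases span_union ht with ht1 | ht2
  · obtain ⟨hA, hdA, hVA⟩ := rerootK_serA h₂ hd hV hF₁ hF₂ hdF hVF hxF₂ hyF₁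
    have hS : F₁ ∪ F₂ ∪ E₂ = F₁ ∪ (F₂ ∪ E₂) := Finset.union_assoc _ _ _
    have hc := spGoodC_cornerK hdA hVA hF₁.symm hA (Finset.inter_subset_right (s₁ := E)) (Finset.inter_subset_right (s₁ := C))
      (Finset.inter_subset_right (s₁ := E)) (Finset.inter_subset_right (s₁ := C)) ht1
      ⟨eb, Finset.mem_union_right _ heb, hbeb⟩ htm htx hbm hbx
    exact hc.rotate'.congr_sets (inter_union2_eq hE hS) (inter_union2_eq hC hS)
  · obtain ⟨hB, hdB, hVB⟩ := rerootK_serB h₂ hd hV hF₁ hF₂ hdF hVF hxF₂ hyF₁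
    have hS : F₁ ∪ F₂ ∪ E₂ = F₂ ∪ (F₁ ∪ E₂) := by ext e; simp only [Finset.mem_union]; tauto
    have hc := spGoodC_cornerK hdB hVB hF₂ hB (Finset.inter_subset_right (s₁ := E)) (Finset.inter_subset_right (s₁ := C))
      (Finset.inter_subset_right (s₁ := E)) (Finset.inter_subset_right (s₁ := C)) ht2
      ⟨eb, Finset.mem_union_right _ heb, hbeb⟩ htm hty hbm hby
    exact hc.rotate'.congr_sets (inter_union2_eq hE hS) (inter_union2_eq hC hS)

/-- Type I on minors, series case with the two marks on different blocks: RING. [cite: AyyerLinussonRavichandran2025, §7 (p. 22)] -/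
theorem typeIK_ring {b s t : V} (h₂ : IsKNet E₂ x y) (hd : Disjoint (F₁ ∪ F₂) E₂)
    (hV : ∀ z : V, (∃ e ∈ F₁ ∪ F₂, z ∈ e) → (∃ e ∈ E₂, z ∈ e) → z = x ∨ z = y)
    (hF₁ : IsKNet F₁ x m) (hF₂ : IsKNet F₂ m y) (hdF : Disjoint F₁ F₂)
    (hVF : ∀ z : V, (∃ e ∈ F₁, z ∈ e) → (∃ e ∈ F₂, z ∈ e) → z = m) (hxF₂ : ∀ e ∈ F₂, x ∉ e) (hyF₁ : ∀ e ∈ F₁, y ∉ e)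
    (hE : E ⊆ F₁ ∪ F₂ ∪ E₂) (hC : C ⊆ F₁ ∪ F₂ ∪ E₂)
    (hs : ∃ e ∈ F₁, s ∈ e) (hsm : s ≠ m) (hsx : s ≠ x) (ht : ∃ e ∈ F₂, t ∈ e) (htm : t ≠ m) (hty : t ≠ y)
    (hb : ∃ e ∈ E₂, b ∈ e) (hbx : b ≠ x) (hby : b ≠ y) : SPGoodC E C b s t := by
  have hd1 : Disjoint F₁ E₂ := (Finset.disjoint_union_left.1 hd).1
  have hd2 : Disjoint F₂ E₂ := (Finset.disjoint_union_left.1 hd).2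
  have hVK1 : ∀ z : V, (∃ e ∈ E₂, z ∈ e) → (∃ e ∈ F₁, z ∈ e) → z = x := fun z hzE hz1 => by
    obtain ⟨f, hf, hzf⟩ := hz1
    rcases hV z ⟨f, Finset.mem_union_left _ hf, hzf⟩ hzE with h | h
    · exact h
    · exact absurd hzf (h ▸ hyF₁ f hf)
  have hVK2 : ∀ z : V, (∃ e ∈ E₂, z ∈ e) → (∃ e ∈ F₂, z ∈ e) → z = y := fun z hzE hz2 => by
    obtain ⟨f, hf, hzf⟩ := hz2
    rcases hV z ⟨f, Finset.mem_union_right _ hf, hzf⟩ hzE with h | h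
    · exact absurd hzf (h ▸ hxF₂ f hf)
    · exact h
  have hu2 : ¬ ∃ e ∈ F₂, x ∈ e := fun ⟨e, he, hxe⟩ => hxF₂ e he hxe
  have hv1 : ¬ ∃ e ∈ F₁, y ∈ e := fun ⟨e, he, hye⟩ => hyF₁ e he hye
  have hS : F₁ ∪ F₂ ∪ E₂ = E₂ ∪ F₁ ∪ F₂ := by ext e; simp only [Finset.mem_union]; tauto
  have hr := spGoodC_ringK hd1.symm hd2.symm hdF hVK1 hVF hVK2 hu2 hv1 hF₁.ne hF₂.ne.symm h₂.symm hF₁ hF₂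
    (Finset.inter_subset_right (s₁ := E)) (Finset.inter_subset_right (s₁ := C)) (Finset.inter_subset_right (s₁ := E))
    (Finset.inter_subset_right (s₁ := C)) (Finset.inter_subset_right (s₁ := E)) (Finset.inter_subset_right (s₁ := C))
    hb hs ht hbx hby hsx hsm hty htm
  exact hr.congr_sets (inter_union3_eq hE hS) (inter_union3_eq hC hS)

include ihSP in
/-- **THE TYPE-I RECURSION ON MINORS.** [cite: AyyerLinussonRavichandran2025, §7 (p. 22)] -/
theorem typeIK_good : ∀ (n : ℕ) {E₁ E₂ E C : Finset (Sym2 V)} {x y b s t : V}, E₁.card ≤ n →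
    IsKNet E₁ x y → IsKNet E₂ x y → Disjoint E₁ E₂ → E₁ ∪ E₂ ⊆ N₀ →
    (∀ z : V, (∃ e ∈ E₁, z ∈ e) → (∃ e ∈ E₂, z ∈ e) → z = x ∨ z = y) →
    E ⊆ E₁ ∪ E₂ → C ⊆ E₁ ∪ E₂ →
    (∃ e ∈ E₁, s ∈ e) → (∃ e ∈ E₁, t ∈ e) → (∃ e ∈ E₂, b ∈ e) →
    s ≠ x → s ≠ y → t ≠ x → t ≠ y → b ≠ x → b ≠ y → s ≠ t → SPGoodC E C b s t := by
  intro n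
  induction n with
  | zero =>
    intro E₁ E₂ E C x y b s t hcard h₁ _ _ _ _ _ _ _ _ _ _ _ _ _ _ _ _
    have := h₁.card_pos
    omega
  | succ n ih =>
    intro E₁ E₂ E C x y b s t hcard h₁ h₂ hd hN hV hE hC hs ht hb hsx hsy htx hty hbx hby hst
    cases h₁ with
    | edge hxy =>
      obtain ⟨e, he, hse⟩ := hs
      rw [Finset.mem_singleton] at he
      subst he
      rcases Sym2.mem_iff.1 hse with h | h
      · exact absurd h hsx
      · exact absurd h hsy
    | @parallel Q₁ Q₂ _ _ hQ₁ hQ₂ hdQ hVQ =>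
      have hlt1 := card_left_lt_of_parallelK hQ₂ hdQ
      have hlt2 := card_right_lt_of_parallelK hQ₁ hdQ
      have hd1 : Disjoint Q₁ E₂ := (Finset.disjoint_union_left.1 hd).1
      have hd2 : Disjoint Q₂ E₂ := (Finset.disjoint_union_left.1 hd).2
      have hVK1 : ∀ z : V, (∃ e ∈ E₂, z ∈ e) → (∃ e ∈ Q₁, z ∈ e) → z = x ∨ z = y := fun z hzE hz1 => by
        obtain ⟨f, hf, hzf⟩ := hz1
        exact hV z ⟨f, Finset.mem_union_left _ hf, hzf⟩ hzE
      have hVK2 : ∀ z : V, (∃ e ∈ E₂, z ∈ e) → (∃ e ∈ Q₂, z ∈ e) → z = x ∨ z = y := fun z hzE hz2 => by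
        obtain ⟨f, hf, hzf⟩ := hz2
        exact hV z ⟨f, Finset.mem_union_right _ hf, hzf⟩ hzE
      obtain ⟨eb, heb, hbeb⟩ := hb
      have eA : Q₁ ∪ Q₂ ∪ E₂ = Q₁ ∪ (Q₂ ∪ E₂) := Finset.union_assoc _ _ _
      have eB : Q₁ ∪ Q₂ ∪ E₂ = Q₂ ∪ (Q₁ ∪ E₂) := by ext e; simp only [Finset.mem_union]; tauto
      rcases span_union hs with hs1 | hs2 <;> rcases span_union ht with ht1 | ht2
      · obtain ⟨hP, hdP, hVP⟩ := rerootK_par h₂ hd hV hQ₂ hdQ hVQ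
        exact ih (by omega) hQ₁ hP hdP (subset_trans (by intro e he; clear * - he; simp only [Finset.mem_union] at he ⊢; tauto) hN) hVP (eA ▸ hE) (eA ▸ hC) hs1 ht1 ⟨eb, Finset.mem_union_right _ heb, hbeb⟩ hsx hsy htx
          hty hbx hby hst
      · have hS : Q₁ ∪ Q₂ ∪ E₂ = E₂ ∪ Q₁ ∪ Q₂ := by ext e; simp only [Finset.mem_union]; tauto
        have hr := spGoodC_thetaK hd1.symm hd2.symm hdQ hVK1 hVK2 hVQ h₂ hQ₁ hQ₂ (Finset.inter_subset_right (s₁ := E))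
          (Finset.inter_subset_right (s₁ := C)) (Finset.inter_subset_right (s₁ := E)) (Finset.inter_subset_right (s₁ := C))
          (Finset.inter_subset_right (s₁ := E)) (Finset.inter_subset_right (s₁ := C)) ⟨eb, heb, hbeb⟩ hs1 ht2 hbx hby hsx
          hsy htx hty
        exact hr.congr_sets (inter_union3_eq hE hS) (inter_union3_eq hC hS)
      · have hS : Q₁ ∪ Q₂ ∪ E₂ = E₂ ∪ Q₂ ∪ Q₁ := by ext e; simp only [Finset.mem_union]; tauto
        have hr := spGoodC_thetaK hd2.symm hd1.symm hdQ.symm hVK2 hVK1 (fun z hz2 hz1 => hVQ z hz1 hz2) h₂ hQ₂ hQ₁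
          (Finset.inter_subset_right (s₁ := E)) (Finset.inter_subset_right (s₁ := C)) (Finset.inter_subset_right (s₁ := E))
          (Finset.inter_subset_right (s₁ := C)) (Finset.inter_subset_right (s₁ := E)) (Finset.inter_subset_right (s₁ := C))
          ⟨eb, heb, hbeb⟩ hs2 ht1 hbx hby hsx hsy htx hty
        exact hr.congr_sets (inter_union3_eq hE hS) (inter_union3_eq hC hS)
      · obtain ⟨hP, hdP, hVP⟩ := rerootK_par' h₂ hd hV hQ₁ hdQ hVQ
        exact ih (by omega) hQ₂ hP hdP (subset_trans (by intro e he; clear * - he; simp only [Finset.mem_union] at he ⊢; tauto) hN) hVP (eB ▸ hE) (eB ▸ hC) hs2 ht2 ⟨eb, Finset.mem_union_right _ heb, hbeb⟩ hsx hsy htx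
          hty hbx hby hst
    | @series F₁ F₂ _ m _ hF₁ hF₂ hdF hVF hxF₂ hyF₁ =>
      have hlt1 := card_left_lt_of_parallelK hF₂ hdF
      have hlt2 := card_right_lt_of_parallelK hF₁ hdF
      by_cases hsm : s = m
      · subst hsm
        exact typeIK_junction h₂ hd hV hF₁ hF₂ hdF hVF hxF₂ hyF₁ hE hC ht (Ne.symm hst) htx hty hb hbx hby
      by_cases htm : t = m
      · subst htm
        exact (typeIK_junction h₂ hd hV hF₁ hF₂ hdF hVF hxF₂ hyF₁ hE hC hs hsm hsx hsy hb hbx hby).swap23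
      obtain ⟨eb, heb, hbeb⟩ := hb
      have hbm : b ≠ m := fun h => junction_not_memK hV hF₁ hF₂ eb heb (h ▸ hbeb)
      have eA : F₁ ∪ F₂ ∪ E₂ = F₁ ∪ (F₂ ∪ E₂) := Finset.union_assoc _ _ _
      have eB : F₁ ∪ F₂ ∪ E₂ = F₂ ∪ (F₁ ∪ E₂) := by ext e; simp only [Finset.mem_union]; tauto
      rcases span_union hs with hs1 | hs2 <;> rcases span_union ht with ht1 | ht2
      · obtain ⟨hA, hdA, hVA⟩ := rerootK_serA h₂ hd hV hF₁ hF₂ hdF hVF hxF₂ hyF₁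
        exact ih (by omega) hF₁.symm hA hdA (subset_trans (by intro e he; clear * - he; simp only [Finset.mem_union] at he ⊢; tauto) hN) hVA (eA ▸ hE) (eA ▸ hC) hs1 ht1 ⟨eb, Finset.mem_union_right _ heb, hbeb⟩ hsm hsx
          htm htx hbm hbx hst
      · exact typeIK_ring h₂ hd hV hF₁ hF₂ hdF hVF hxF₂ hyF₁ hE hC hs1 hsm hsx ht2 htm hty ⟨eb, heb, hbeb⟩ hbx hby
      · exact (typeIK_ring h₂ hd hV hF₁ hF₂ hdF hVF hxF₂ hyF₁ hE hC ht1 htm htx hs2 hsm hsy ⟨eb, heb, hbeb⟩ hbx hby).swap23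
      · obtain ⟨hB, hdB, hVB⟩ := rerootK_serB h₂ hd hV hF₁ hF₂ hdF hVF hxF₂ hyF₁
        exact ih (by omega) hF₂ hB hdB (subset_trans (by intro e he; clear * - he; simp only [Finset.mem_union] at he ⊢; tauto) hN) hVB (eB ▸ hE) (eB ▸ hC) hs2 ht2 ⟨eb, Finset.mem_union_right _ heb, hbeb⟩ hsm hsy htm
          hty hbm hby hst

    | @bridge Qac Qad Qbc Qbd Qcd _ _ c d hac had hbc hbd hcd hsep =>
      -- census g41: the side being decomposed is a BRIDGE — «Pat3KNetSPBridgeI» dispatches on the positions of `s, t`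
      -- (views at a slot + `ih`, CORNER / 𝒯₂(𝒦) leaves); the five K-state leaves are the SPEC theorems of «Pat3KNetSPLeavesI» (draft).
      exact typeIK_bridge_dispatch (fun hc h1 h2 hd' hN' hV' hE' hC' hs' ht' hb' => ih hc h1 h2 hd' hN' hV' hE' hC' hs' ht' hb')
        (spGoodC_bridgeLeaf_tri ihSP) (spGoodC_bridgeLeaf_claw ihSP) (spGoodC_bridgeLeaf_pathMid ihSP) (spGoodC_bridgeLeaf_pathEnd ihSP) (spGoodC_bridgeLeaf_vee ihSP)
        hac had hbc hbd hcd hsep hcard h₂ hd hN hV hE hC hb hbx hby hs ht hsx hsy htx hty hst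
end TypeIC

/-! ### One marked terminal, on minors -/

section OneTerminalC

variable [Fintype V] {F₁ F₂ E₂ : Finset (Sym2 V)} {x m y : V} {E C : Finset (Sym2 V)}

variable {N₀ : Finset (Sym2 V)}
  (ihSP : ∀ {N' E' C' : Finset (Sym2 V)} {x' y' b' s' t' : V}, N'.card < N₀.card → IsKNet N' x' y' → E' ⊆ N' → C' ⊆ N' →
    (∃ e ∈ N', b' ∈ e) → (∃ e ∈ N', s' ∈ e) → (∃ e ∈ N', t' ∈ e) → b' ≠ s' → b' ≠ t' → s' ≠ t' → SPGoodC E' C' b' s' t')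

/-- One marked terminal on minors, series case with the junction marked: cut `{x, m}` = two marks (`FK.spGoodC_parTwoK`).
[cite: AyyerLinussonRavichandran2025, §7 (p. 22)] -/
theorem pbK_junction {t : V} (h₂ : IsKNet E₂ x y) (hd : Disjoint (F₁ ∪ F₂) E₂)
    (hV : ∀ z : V, (∃ e ∈ F₁ ∪ F₂, z ∈ e) → (∃ e ∈ E₂, z ∈ e) → z = x ∨ z = y)
    (hF₁ : IsKNet F₁ x m) (hF₂ : IsKNet F₂ m y) (hdF : Disjoint F₁ F₂)
    (hVF : ∀ z : V, (∃ e ∈ F₁, z ∈ e) → (∃ e ∈ F₂, z ∈ e) → z = m) (hxF₂ : ∀ e ∈ F₂, x ∉ e) (hyF₁ : ∀ e ∈ F₁, y ∉ e)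
    (hE : E ⊆ F₁ ∪ F₂ ∪ E₂) (hC : C ⊆ F₁ ∪ F₂ ∪ E₂)
    (ht : ∃ e ∈ F₁ ∪ F₂, t ∈ e) (htm : t ≠ m) (htx : t ≠ x) : SPGoodC E C x m t := by
  obtain ⟨hA, hdA, hVA⟩ := rerootK_serA h₂ hd hV hF₁ hF₂ hdF hVF hxF₂ hyF₁
  have hVA' : ∀ z : V, (∃ e ∈ F₁, z ∈ e) → (∃ e ∈ F₂ ∪ E₂, z ∈ e) → z = x ∨ z = m := fun z h1 h => (hVA z h1 h).symm
  rcases span_union ht with ht1 | ht2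
  · have hS : F₁ ∪ F₂ ∪ E₂ = F₂ ∪ E₂ ∪ F₁ := by ext e; simp only [Finset.mem_union]; tauto
    have hr := spGoodC_parTwoK hdA.symm (fun z h h1 => hVA' z h1 h) hF₁.ne hF₁ (Finset.inter_subset_right (s₁ := E))
      (Finset.inter_subset_right (s₁ := C)) (Finset.inter_subset_right (s₁ := E)) (Finset.inter_subset_right (s₁ := C)) ht1 htx htm
    exact hr.congr_sets (inter_union2_eq hE hS) (inter_union2_eq hC hS)
  · have hS : F₁ ∪ F₂ ∪ E₂ = F₁ ∪ (F₂ ∪ E₂) := Finset.union_assoc _ _ _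
    have hr := spGoodC_parTwoK hdA hVA' hF₁.ne hA.symm (Finset.inter_subset_right (s₁ := E))
      (Finset.inter_subset_right (s₁ := C)) (Finset.inter_subset_right (s₁ := E)) (Finset.inter_subset_right (s₁ := C))
      ⟨ht2.choose, Finset.mem_union_left _ ht2.choose_spec.1, ht2.choose_spec.2⟩ htx htm
    exact hr.congr_sets (inter_union2_eq hE hS) (inter_union2_eq hC hS)

include ihSP in
/-- **ONE MARKED TERMINAL ON MINORS.** [cite: AyyerLinussonRavichandran2025, §7 (p. 22)] -/
theorem pbK_good : ∀ (n : ℕ) {E₁ E₂ E C : Finset (Sym2 V)} {x y s t : V}, E₁.card ≤ n →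
    IsKNet E₁ x y → IsKNet E₂ x y → Disjoint E₁ E₂ → E₁ ∪ E₂ ⊆ N₀ →
    (∀ z : V, (∃ e ∈ E₁, z ∈ e) → (∃ e ∈ E₂, z ∈ e) → z = x ∨ z = y) →
    E ⊆ E₁ ∪ E₂ → C ⊆ E₁ ∪ E₂ →
    (∃ e ∈ E₁, s ∈ e) → (∃ e ∈ E₁, t ∈ e) →
    s ≠ x → s ≠ y → t ≠ x → t ≠ y → s ≠ t → SPGoodC E C x s t := by
  intro n
  induction n with
  | zero =>
    intro E₁ E₂ E C x y s t hcard h₁ _ _ _ _ _ _ _ _ _ _ _ _ _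
    have := h₁.card_pos
    omega
  | succ n ih =>
    intro E₁ E₂ E C x y s t hcard h₁ h₂ hd hN hV hE hC hs ht hsx hsy htx hty hst
    cases h₁ with
    | edge hxy =>
      obtain ⟨e, he, hse⟩ := hs
      rw [Finset.mem_singleton] at he
      subst he
      rcases Sym2.mem_iff.1 hse with h | h
      · exact absurd h hsx
      · exact absurd h hsy
    | @parallel Q₁ Q₂ _ _ hQ₁ hQ₂ hdQ hVQ =>
      have hlt1 := card_left_lt_of_parallelK hQ₂ hdQ
      have hlt2 := card_right_lt_of_parallelK hQ₁ hdQ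
      obtain ⟨hP, hdP, hVP⟩ := rerootK_par h₂ hd hV hQ₂ hdQ hVQ
      obtain ⟨hP', hdP', hVP'⟩ := rerootK_par' h₂ hd hV hQ₁ hdQ hVQ
      have eA : Q₁ ∪ Q₂ ∪ E₂ = Q₁ ∪ (Q₂ ∪ E₂) := Finset.union_assoc _ _ _
      have eB : Q₁ ∪ Q₂ ∪ E₂ = Q₂ ∪ (Q₁ ∪ E₂) := by ext e; simp only [Finset.mem_union]; tauto
      rcases span_union hs with hs1 | hs2 <;> rcases span_union ht with ht1 | ht2
      · exact ih (by omega) hQ₁ hP hdP (subset_trans (by intro e he; clear * - he; simp only [Finset.mem_union] at he ⊢; tauto) hN) hVP (eA ▸ hE) (eA ▸ hC) hs1 ht1 hsx hsy htx hty hst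
      · have hr := spGoodC_cornerK hdP hVP hQ₁ hP (Finset.inter_subset_right (s₁ := E)) (Finset.inter_subset_right (s₁ := C))
          (Finset.inter_subset_right (s₁ := E)) (Finset.inter_subset_right (s₁ := C)) hs1
          ⟨ht2.choose, Finset.mem_union_left _ ht2.choose_spec.1, ht2.choose_spec.2⟩ hsx hsy htx hty
        exact hr.congr_sets (inter_union2_eq hE eA) (inter_union2_eq hC eA)
      · have hr := spGoodC_cornerK hdP' hVP' hQ₂ hP' (Finset.inter_subset_right (s₁ := E)) (Finset.inter_subset_right (s₁ := C))
          (Finset.inter_subset_right (s₁ := E)) (Finset.inter_subset_right (s₁ := C)) hs2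
          ⟨ht1.choose, Finset.mem_union_left _ ht1.choose_spec.1, ht1.choose_spec.2⟩ hsx hsy htx hty
        exact hr.congr_sets (inter_union2_eq hE eB) (inter_union2_eq hC eB)
      · exact ih (by omega) hQ₂ hP' hdP' (subset_trans (by intro e he; clear * - he; simp only [Finset.mem_union] at he ⊢; tauto) hN) hVP' (eB ▸ hE) (eB ▸ hC) hs2 ht2 hsx hsy htx hty hst
    | @series F₁ F₂ _ m _ hF₁ hF₂ hdF hVF hxF₂ hyF₁ =>
      have hlt1 := card_left_lt_of_parallelK hF₂ hdF
      have hlt2 := card_right_lt_of_parallelK hF₁ hdF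
      by_cases hsm : s = m
      · subst hsm
        exact pbK_junction h₂ hd hV hF₁ hF₂ hdF hVF hxF₂ hyF₁ hE hC ht (Ne.symm hst) htx
      by_cases htm : t = m
      · subst htm
        exact (pbK_junction h₂ hd hV hF₁ hF₂ hdF hVF hxF₂ hyF₁ hE hC hs hsm hsx).swap23
      obtain ⟨hA, hdA, hVA⟩ := rerootK_serA h₂ hd hV hF₁ hF₂ hdF hVF hxF₂ hyF₁
      have hVA' : ∀ z : V, (∃ e ∈ F₁, z ∈ e) → (∃ e ∈ F₂ ∪ E₂, z ∈ e) → z = x ∨ z = m :=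
        fun z h1 h => (hVA z h1 h).symm
      obtain ⟨hB, hdB, hVB⟩ := rerootK_serB h₂ hd hV hF₁ hF₂ hdF hVF hxF₂ hyF₁
      have eA : F₁ ∪ F₂ ∪ E₂ = F₁ ∪ (F₂ ∪ E₂) := Finset.union_assoc _ _ _
      have eB : F₁ ∪ F₂ ∪ E₂ = F₂ ∪ (F₁ ∪ E₂) := by ext e; simp only [Finset.mem_union]; tauto
      rcases span_union hs with hs1 | hs2 <;> rcases span_union ht with ht1 | ht2
      · exact ih (by omega) hF₁ hA.symm hdA (subset_trans (by intro e he; clear * - he; simp only [Finset.mem_union] at he ⊢; tauto) hN) hVA' (eA ▸ hE) (eA ▸ hC) hs1 ht1 hsx hsm htx htm hst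
      · have hr := spGoodC_cornerK hdA hVA' hF₁ hA.symm (Finset.inter_subset_right (s₁ := E)) (Finset.inter_subset_right (s₁ := C))
          (Finset.inter_subset_right (s₁ := E)) (Finset.inter_subset_right (s₁ := C)) hs1
          ⟨ht2.choose, Finset.mem_union_left _ ht2.choose_spec.1, ht2.choose_spec.2⟩ hsx hsm htx htm
        exact hr.congr_sets (inter_union2_eq hE eA) (inter_union2_eq hC eA)
      · have hr := spGoodC_cornerK hdA hVA' hF₁ hA.symm (Finset.inter_subset_right (s₁ := E)) (Finset.inter_subset_right (s₁ := C))
          (Finset.inter_subset_right (s₁ := E)) (Finset.inter_subset_right (s₁ := C)) ht1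
          ⟨hs2.choose, Finset.mem_union_left _ hs2.choose_spec.1, hs2.choose_spec.2⟩ htx htm hsx hsm
        exact hr.swap23.congr_sets (inter_union2_eq hE eA) (inter_union2_eq hC eA)
      · obtain ⟨ex, hex, hxex⟩ := hF₁.left_mem
        exact typeIK_good ihSP F₂.card le_rfl hF₂ hB hdB (subset_trans (by intro e he; clear * - he; simp only [Finset.mem_union] at he ⊢; tauto) hN) hVB (eB ▸ hE) (eB ▸ hC) hs2 ht2 ⟨ex, Finset.mem_union_left _ hex, hxex⟩
          hsm hsy htm hty hF₁.ne h₂.ne hst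

    | @bridge Qac Qad Qbc Qbd Qcd _ _ c d hac had hbc hbd hcd hsep =>
      -- census g41: BRIDGE side with the pole `x` marked — «Pat3KNetSPBridgePb» (views + type I + CORNER + 𝒯₂(𝒦)), modulo the two
      -- VEE* leaf SPECs of «Pat3KNetSPLeavesI» (draft).
      exact pbK_bridge_dispatch
        (fun h1 h2 hd' hN' hV' hE' hC' hs' ht' hb' hsx' hsy' htx' hty' hbx' hby' hst' =>
          typeIK_good ihSP _ le_rfl h1 h2 hd' hN' hV' hE' hC' hs' ht' hb' hsx' hsy' htx' hty' hbx' hby' hst')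
        (fun hc h1 h2 hd' hN' hV' hE' hC' hs' ht' => ih hc h1 h2 hd' hN' hV' hE' hC' hs' ht')
        (spGoodC_bridgeLeaf_veeY ihSP) (spGoodC_bridgeLeaf_veeC ihSP)
        hac had hbc hbd hcd hsep h₂ hd hN hV hE hC hcard hs ht hsx hsy htx hty hst
end OneTerminalC

end FK

end Summit.CriticalPhenomena.PercolationContinuityZ3.Theorems
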